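import Literature.Analysis.Fourier.ChirpOscillatory
import HarnessLib

/-!
# Truncated alias kernels of a chirp: smoothness in the frequency and uniform tail bounds

For a chirp phase `φ` (`ChirpPhase φ H L Cφ`), an integer `k` and a real compactly supported
weight `m` on `(H, ∞)` the *truncated alias kernel* is
`K(u) = ∫_{τ>H} m(τ) e^{i(uτ + 2πkφ(τ))} dτ` (`aliasKT`). We prove:
* `iteratedDeriv_aliasKT`, `contDiff_aliasKT`: `K` is smooth in `u` and
  `K^{(l)}(u) = i^l ∫_{τ>H} τ^l m(τ) e^{i(uτ+2πkφ)} dτ` (differentiation under the integral sign,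
  `hasDerivAt_integral_of_dominated_loc_of_deriv_le`);
* `integral_ft_mul_eq_integral_mul_aliasKT`: Fubini,
  `∫_{τ>H} Ĝ(τ) m(τ) e^{2πikφ(τ)} dτ = ∫ G(u) K(u) du` for continuous compactly supported `G`,
  `Ĝ(τ) = ∫ G(u) e^{iuτ} du`;
* `exists_tail_bound`: for a uniform symbol family of good amplitudes `a_i` of order `l` and
  frequencies `|u_i| ≤ c' < 2πL`, `k_i ≠ 0`: `‖∫_{τ>H} a_i e‖ ≤ C T₀^{-1/2}` whenever `a_i`
  vanishes below `T₀` (`l + 2` integrations by parts, `integral_amp_chirpE_eq_iterate`, and the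
  symbol calculus);
* `exists_contDiff_limit_of_uniformCauchy`: a sequence of smooth functions all of whose
  derivatives are uniformly Cauchy converges with all derivatives to a smooth function.
Sources: Stein, *Harmonic Analysis* (1993), VIII §1; Rudin, *Principles*, Thm 7.17. All proved,
no named facts.
-/

noncomputable section

open Set Filter MeasureTheory
open scoped Topology ContDiff Real

namespace Literature.Analysis.Fourier

open _root_.Complex (I exp)

variable {ι : Type*}

/-! ## Smooth limits -/

/-- **Smooth limits** (Rudin, *Principles of Mathematical Analysis*, Thm 7.17, iterated): if
`f_m : ℝ → ℂ` are smooth and each sequence of iterated derivatives `(f_m^{(j)})_m` is uniformly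
Cauchy on `ℝ`, there is a smooth `F` with `f_m^{(j)} → F^{(j)}` uniformly for every `j`.
[folklore] -/
theorem exists_contDiff_limit_of_uniformCauchy {f : ℕ → ℝ → ℂ} (hf : ∀ m, ContDiff ℝ ∞ (f m))
    (hC : ∀ j : ℕ, ∀ ε > (0 : ℝ), ∃ N : ℕ, ∀ m ≥ N, ∀ m' ≥ N, ∀ x : ℝ,
      ‖iteratedDeriv j (f m) x - iteratedDeriv j (f m') x‖ < ε) :
    ∃ F : ℝ → ℂ, ContDiff ℝ ∞ F ∧
      ∀ j, TendstoUniformly (fun m => iteratedDeriv j (f m)) (iteratedDeriv j F) atTop := by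
  have hUC : ∀ j, UniformCauchySeqOn (fun m => iteratedDeriv j (f m)) atTop univ := by
    intro j
    rw [Metric.uniformCauchySeqOn_iff]
    intro ε hε
    obtain ⟨N, hN⟩ := hC j ε hε
    exact ⟨N, fun m hm m' hm' x _ => by rw [dist_eq_norm]; exact hN m hm m' hm' x⟩
  have hlim : ∀ j, ∃ g : ℝ → ℂ, TendstoUniformly (fun m => iteratedDeriv j (f m)) g atTop := by
    intro j
    have hpt : ∀ x, ∃ y, Tendsto (fun m => iteratedDeriv j (f m) x) atTop (𝓝 y) := fun x =>
      cauchySeq_tendsto_of_complete ((hUC j).cauchySeq (mem_univ x))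
    choose g hg using hpt
    exact ⟨g, tendstoUniformlyOn_univ.mp ((hUC j).tendstoUniformlyOn_of_tendsto fun x _ => hg x)⟩
  choose g hg using hlim
  have hderiv : ∀ j x, HasDerivAt (g j) (g (j + 1) x) x := by
    intro j x
    refine hasDerivAt_of_tendstoUniformly (hg (j + 1)) (Eventually.of_forall fun m y => ?_)
      (fun y => (hg j).tendsto_at y) x
    rw [iteratedDeriv_succ]
    exact (((hf m).differentiable_iteratedDeriv j
      (WithTop.coe_lt_coe.mpr (ENat.coe_lt_top j))).differentiableAt).hasDerivAt
  have hiter : ∀ j, iteratedDeriv j (g 0) = g j := by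
    intro j
    induction j with
    | zero => simp
    | succ j ih =>
      rw [iteratedDeriv_succ, ih]
      funext x
      exact (hderiv j x).deriv
  refine ⟨g 0, ?_, fun j => by rw [hiter]; exact hg j⟩
  refine contDiff_of_differentiable_iteratedDeriv (n := (⊤ : ℕ∞)) fun m _ => ?_
  rw [hiter]
  exact fun x => (hderiv m x).differentiableAt

/-! ## The truncated alias kernel and its derivatives -/

/-- The truncated alias kernel `K(u) = ∫_{τ>H} m(τ) e^{i(uτ + 2πkφ(τ))} dτ`. [folklore] -/
def aliasKT (φ : ℝ → ℝ) (H : ℝ) (m : ℝ → ℝ) (k : ℤ) (u : ℝ) : ℂ :=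
  ∫ τ in Ioi H, (m τ : ℂ) * chirpE φ k u τ

/-- The integrand of `K^{(l)}`: `i^l τ^l m(τ) e^{i(uτ + 2πkφ)}`. [folklore] -/
def aliasF (φ : ℝ → ℝ) (m : ℝ → ℝ) (k : ℤ) (l : ℕ) (u τ : ℝ) : ℂ :=
  I ^ l * (((τ ^ l * m τ : ℝ) : ℂ) * chirpE φ k u τ)

/-- `∂_u e^{i(uτ + 2πkφ)} = iτ e^{i(uτ+2πkφ)}`. [folklore] -/
theorem hasDerivAt_chirpE_param (φ : ℝ → ℝ) (k : ℤ) (τ u : ℝ) :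
    HasDerivAt (fun u => chirpE φ k u τ) (chirpE φ k u τ * ((τ : ℂ) * I)) u := by
  unfold chirpE
  have h1 : HasDerivAt (fun u : ℝ => u * τ + 2 * π * k * φ τ) (1 * τ) u :=
    ((hasDerivAt_id u).mul_const τ).add_const _
  exact (h1.ofReal_comp.mul_const I).cexp.congr_deriv (by push_cast; ring)

/-- `e^{i(uτ + 2πkφ(τ))}` is jointly continuous in `(τ, u)`. [folklore] -/
theorem continuous_chirpE_uncurry {φ : ℝ → ℝ} (hφ : Continuous φ) (k : ℤ) :
    Continuous (fun p : ℝ × ℝ => chirpE φ k p.2 p.1) := by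
  unfold chirpE; fun_prop

/-- The integrands `aliasF` are continuous in `τ`. [folklore] -/
theorem continuous_aliasF {φ : ℝ → ℝ} (hφ : Continuous φ) {m : ℝ → ℝ} (hm : Continuous m)
    (k : ℤ) (l : ℕ) (u : ℝ) : Continuous (aliasF φ m k l u) := by
  unfold aliasF
  exact continuous_const.mul ((Complex.continuous_ofReal.comp ((continuous_pow l).mul hm)).mul
    (continuous_chirpE hφ k u))

/-- `‖aliasF‖ = |τ|^l |m(τ)|`. [folklore] -/
theorem norm_aliasF (φ : ℝ → ℝ) (m : ℝ → ℝ) (k : ℤ) (l : ℕ) (u τ : ℝ) :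
    ‖aliasF φ m k l u τ‖ = |τ| ^ l * |m τ| := by
  unfold aliasF
  rw [norm_mul, norm_pow, Complex.norm_I, one_pow, one_mul, norm_mul, norm_chirpE, mul_one,
    Complex.norm_real, Real.norm_eq_abs, abs_mul, abs_pow]

/-- **Differentiation under the integral sign** for the truncated kernels: `u ↦ ∫ aliasF_l`
has derivative `∫ aliasF_{l+1}` (the weight `m` is continuous and compactly supported in
`(H, ∞)`). [folklore] -/
theorem hasDerivAt_integral_aliasF {φ : ℝ → ℝ} {H : ℝ} (hφ : Continuous φ) {m : ℝ → ℝ}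
    (hm : Continuous m) (hz : ∀ τ, τ < H + 1 / 4 → m τ = 0) {R : ℝ} (hR : ∀ τ, R < τ → m τ = 0)
    (k : ℤ) (l : ℕ) (u₀ : ℝ) :
    HasDerivAt (fun u => ∫ τ in Ioi H, aliasF φ m k l u τ)
      (∫ τ in Ioi H, aliasF φ m k (l + 1) u₀ τ) u₀ := by
  have hint : ∀ l' u, IntegrableOn (aliasF φ m k l' u) (Ioi H) := fun l' u =>
    integrableOn_Ioi_of_zero (R := R) (continuous_aliasF hφ hm k l' u).continuousOn
      (fun τ hτ => by simp [aliasF, hz τ hτ]) (fun τ hτ => by simp [aliasF, hR τ hτ])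
  have hbi : IntegrableOn (fun τ : ℝ => |τ| ^ (l + 1) * |m τ|) (Ioi H) :=
    integrableOn_Ioi_of_zero (R := R) (by fun_prop : Continuous fun τ : ℝ => |τ| ^ (l + 1) * |m τ|).continuousOn
      (fun τ hτ => by simp [hz τ hτ]) (fun τ hτ => by simp [hR τ hτ])
  have key := hasDerivAt_integral_of_dominated_loc_of_deriv_le (μ := volume.restrict (Ioi H))
    (F := fun u τ => aliasF φ m k l u τ) (F' := fun u τ => aliasF φ m k (l + 1) u τ) (x₀ := u₀)
    (bound := fun τ => |τ| ^ (l + 1) * |m τ|) (s := univ) univ_mem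
    (Eventually.of_forall fun u => (continuous_aliasF hφ hm k l u).aestronglyMeasurable)
    (hint l u₀) (continuous_aliasF hφ hm k (l + 1) u₀).aestronglyMeasurable
    (Eventually.of_forall fun τ u _ => (norm_aliasF φ m k (l + 1) u τ).le) hbi
    (Eventually.of_forall fun τ u _ => ?_)
  · exact key.2
  · unfold aliasF
    refine (((hasDerivAt_chirpE_param φ k τ u).const_mul _).const_mul _).congr_deriv ?_
    push_cast
    ring

/-- **The derivatives of the truncated kernel**: `K^{(l)}(u) = ∫_{τ>H} aliasF_l(u, τ) dτ`.
[folklore] -/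
theorem iteratedDeriv_aliasKT {φ : ℝ → ℝ} {H : ℝ} (hφ : Continuous φ) {m : ℝ → ℝ}
    (hm : Continuous m) (hz : ∀ τ, τ < H + 1 / 4 → m τ = 0) {R : ℝ} (hR : ∀ τ, R < τ → m τ = 0)
    (k : ℤ) (l : ℕ) :
    iteratedDeriv l (aliasKT φ H m k) = fun u => ∫ τ in Ioi H, aliasF φ m k l u τ := by
  induction l with
  | zero =>
    funext u
    simp [aliasKT, aliasF]
  | succ l ih =>
    rw [iteratedDeriv_succ, ih]
    funext u
    exact (hasDerivAt_integral_aliasF hφ hm hz hR k l u).deriv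

/-- The same with the constant `i^l` pulled out. [folklore] -/
theorem iteratedDeriv_aliasKT_apply {φ : ℝ → ℝ} {H : ℝ} (hφ : Continuous φ) {m : ℝ → ℝ}
    (hm : Continuous m) (hz : ∀ τ, τ < H + 1 / 4 → m τ = 0) {R : ℝ} (hR : ∀ τ, R < τ → m τ = 0)
    (k : ℤ) (l : ℕ) (u : ℝ) :
    iteratedDeriv l (aliasKT φ H m k) u =
      I ^ l * ∫ τ in Ioi H, ((τ ^ l * m τ : ℝ) : ℂ) * chirpE φ k u τ := by
  rw [iteratedDeriv_aliasKT hφ hm hz hR k l]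
  exact integral_const_mul _ _

/-- **The truncated kernel is smooth in the frequency.** [folklore] -/
theorem contDiff_aliasKT {φ : ℝ → ℝ} {H : ℝ} (hφ : Continuous φ) {m : ℝ → ℝ}
    (hm : Continuous m) (hz : ∀ τ, τ < H + 1 / 4 → m τ = 0) {R : ℝ} (hR : ∀ τ, R < τ → m τ = 0)
    (k : ℤ) : ContDiff ℝ ∞ (aliasKT φ H m k) := by
  refine contDiff_of_differentiable_iteratedDeriv (n := (⊤ : ℕ∞)) fun l _ => ?_
  rw [iteratedDeriv_aliasKT hφ hm hz hR k l]
  exact fun u => (hasDerivAt_integral_aliasF hφ hm hz hR k l u).differentiableAt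

/-! ## Fubini: pairing with a Fourier transform -/

/-- **Fubini.** For continuous compactly supported `G` with `Ĝ(τ) = ∫ G(x) e^{ixτ} dx`:
`∫_{τ>H} Ĝ(τ) m(τ) e^{2πikφ(τ)} dτ = ∫ G(x) K(x) dx`. [folklore] -/
theorem integral_ft_mul_eq_integral_mul_aliasKT {φ : ℝ → ℝ} {H : ℝ} (hφ : Continuous φ)
    {m : ℝ → ℝ} (hm : Continuous m) (hz : ∀ τ, τ < H + 1 / 4 → m τ = 0) {R : ℝ}
    (hR : ∀ τ, R < τ → m τ = 0) (k : ℤ) {G : ℝ → ℂ} (hG : Continuous G)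
    (hGs : HasCompactSupport G) :
    ∫ τ in Ioi H, (∫ x, G x * exp (((x * τ : ℝ) : ℂ) * I)) * (m τ : ℂ) *
        exp (((2 * π * k * φ τ : ℝ) : ℂ) * I) = ∫ x, G x * aliasKT φ H m k x := by
  set f : ℝ → ℝ → ℂ := fun τ x => G x * ((m τ : ℂ) * chirpE φ k x τ) with hf
  have h1 : ∀ τ, (∫ x, G x * exp (((x * τ : ℝ) : ℂ) * I)) * (m τ : ℂ) *
      exp (((2 * π * k * φ τ : ℝ) : ℂ) * I) = ∫ x, f τ x := by
    intro τ
    rw [mul_assoc, ← integral_mul_const]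
    refine integral_congr_ae (Eventually.of_forall fun x => ?_)
    simp only [hf, chirpE]
    rw [show (((x * τ + 2 * π * k * φ τ : ℝ)) : ℂ) * I = ((x * τ : ℝ) : ℂ) * I +
      ((2 * π * k * φ τ : ℝ) : ℂ) * I by push_cast; ring, Complex.exp_add]
    ring
  simp_rw [h1]
  have hcont : Continuous (Function.uncurry f) := by
    simp only [hf, Function.uncurry_def, chirpE]
    fun_prop
  have hmi : Integrable (fun τ => |m τ|) (volume.restrict (Ioi H)) :=
    integrableOn_Ioi_of_zero (R := R) (continuous_abs.comp hm).continuousOn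
      (fun τ hτ => by simp [hz τ hτ]) (fun τ hτ => by simp [hR τ hτ])
  have hGi : Integrable (fun x => ‖G x‖) := (hG.norm).integrable_of_hasCompactSupport hGs.norm
  have hprod : Integrable (Function.uncurry f) ((volume.restrict (Ioi H)).prod volume) := by
    refine (hmi.mul_prod hGi).mono' hcont.aestronglyMeasurable (Eventually.of_forall fun p => ?_)
    obtain ⟨τ, x⟩ := p
    simp only [hf, Function.uncurry_apply_pair]
    rw [norm_mul, norm_mul, norm_chirpE, Complex.norm_real, Real.norm_eq_abs]
    linarith [mul_comm (‖G x‖) (|m τ|)]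
  rw [integral_integral_swap hprod]
  refine integral_congr_ae (Eventually.of_forall fun x => ?_)
  simp only [hf, aliasKT]
  rw [← integral_const_mul]

/-! ## Uniform tail bounds by integration by parts -/

/-- **Uniform tail bound for a symbol family of good amplitudes.** For a chirp phase, integer
modes `k_i ≠ 0`, frequencies `|u_i| ≤ c' < 2πL`, and a smooth uniform symbol family `a_i` of
order `l` of good amplitudes: there is `C` such that `‖∫_{τ>H} a_i e_i‖ ≤ C T₀^{-1/2}` whenever
`a_i` vanishes below `T₀ ≥ H` (`l + 2` integrations by parts). [folklore] -/
theorem exists_tail_bound {φ : ℝ → ℝ} {H L : ℝ} {Cφ : ℕ → ℝ} (hφ : ChirpPhase φ H L Cφ)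
    {S : Set ι} (k : ι → ℤ) (u : ι → ℝ) {c' : ℝ} (hc' : 0 ≤ c') (hcL : c' < 2 * π * L)
    (hS : ∀ i ∈ S, k i ≠ 0 ∧ |u i| ≤ c') {a : ι → ℝ → ℝ} {l : ℕ} (ha : SmoothFam S H a)
    (has : ∀ R, SymBnd S H l R a) (hgood : ∀ i ∈ S, GoodAmp H (a i)) :
    ∃ C, 0 ≤ C ∧ ∀ i ∈ S, ∀ T₀, H ≤ T₀ → (∀ τ, τ < T₀ → a i τ = 0) →
      ‖∫ τ in Ioi H, (a i τ : ℂ) * chirpE φ (k i) (u i) τ‖ ≤ C * T₀ ^ (-(1 / 2) : ℝ) := by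
  have hH := hφ.one_le
  set ε : ι → ℝ := fun i => u i / (2 * π * k i) with hε_def
  set ε₀ : ℝ := c' / (2 * π) with hε₀_def
  have hε₀ : 0 ≤ ε₀ := by positivity
  have hε₀L : ε₀ < L := by
    rw [hε₀_def, div_lt_iff₀ (by positivity)]
    linarith
  have hε : ∀ i ∈ S, |ε i| ≤ ε₀ := by
    intro i hi
    obtain ⟨hk, hu⟩ := hS i hi
    have hk1 : (1 : ℝ) ≤ |(k i : ℝ)| := by
      rw [← Int.cast_abs]; exact_mod_cast Int.one_le_abs hk
    rw [hε_def, hε₀_def]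
    simp only [abs_div, abs_mul, abs_two, abs_of_pos Real.pi_pos]
    rw [div_le_div_iff₀ (by positivity) (by positivity)]
    calc |u i| * (2 * π) ≤ c' * (2 * π) * 1 := by rw [mul_one]; gcongr
      _ ≤ c' * (2 * π) * |(k i : ℝ)| := by gcongr
      _ = c' * (2 * π * |(k i : ℝ)|) := by ring
  set v : ι → ℝ → ℝ := fun i τ => (ε i + deriv φ τ)⁻¹ with hv_def
  have hv : SmoothFam S H v := hφ.smoothFam_inv_const_add_deriv S ε hε₀L hε
  have hvs : ∀ R, SymBnd S H 0 R v := fun R => hφ.symBnd_inv_const_add_deriv S ε hε₀ hε₀L hε R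
  have hden : ∀ i ∈ S, ∀ τ, H < τ → 0 < u i / (2 * π * k i) + deriv φ τ := fun i hi τ hτ =>
    (sub_pos.mpr hε₀L).trans_le (hφ.const_add_deriv_ge hε i hi τ hτ)
  obtain ⟨_, hD⟩ := symBnd_iterate_Dfam hH hv hvs (l + 2) l 0 a ha (has _)
  have hD' : SymBnd S H (-2) 0 ((Dfam v)^[l + 2] a) := hD.of_eq (by push_cast; ring)
  obtain ⟨C, hC, hCb⟩ := hD'.exists_le_rpow hH le_rfl
  refine ⟨2 * C, by positivity, fun i hi T₀ hT₀ hzero => ?_⟩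
  obtain ⟨hk, _⟩ := hS i hi
  have hvi : v i = vInv φ (k i) (u i) := rfl
  have hvis : ContDiffOn ℝ ∞ (vInv φ (k i) (u i)) (Ioi H) := hvi ▸ hv i hi
  rw [integral_amp_chirpE_eq_iterate hφ hk (hden i hi) (hgood i hi) (l + 2)]
  -- the iterated amplitude
  set b : ℝ → ℝ := (Dop1 (vInv φ (k i) (u i)))^[l + 2] (a i) with hb_def
  have hb_eq : b = ((Dfam v)^[l + 2] a) i := by
    rw [iterate_Dfam_apply]
    exact rfl
  have hbgood : GoodAmp H b := (hgood i hi).iterate hvis (l + 2)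
  have hbz : ∀ τ, H < τ → τ < T₀ → b τ = 0 := fun τ _ hτ =>
    iterate_Dop1_eq_zero_of_eqOn isOpen_Iio _ (fun τ hτ => hzero τ hτ) (l + 2) τ hτ
  have hbb : ∀ τ, H < τ → |b τ| ≤ C * τ ^ (-(3 / 2) : ℝ) := fun τ hτ => by
    rw [hb_eq]; exact hCb i hi τ hτ
  obtain ⟨hbs, hbz', Rb, hbR⟩ := hbgood
  have hbi : IntegrableOn (fun τ => (b τ : ℂ) * chirpE φ (k i) (u i) τ) (Ioi H) :=
    integrableOn_Ioi_of_zero (R := Rb)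
      ((Complex.continuous_ofReal.comp_continuousOn hbs.continuousOn).mul
        (continuous_chirpE hφ.smooth.continuous _ _).continuousOn)
      (fun τ hτ => by simp [hbz' τ hτ]) (fun τ hτ => by simp [hbR τ hτ])
  have htail := norm_integral_amp_chirpE_le (k i) (u i) hH hT₀ hbi hbb hbz
  have hq : ‖(I / (2 * π * (k i : ℂ))) ^ (l + 2)‖ ≤ 1 := by
    rw [norm_pow]
    apply pow_le_one₀ (norm_nonneg _)
    have hk1 : (1 : ℝ) ≤ |(k i : ℝ)| := by
      rw [← Int.cast_abs]; exact_mod_cast Int.one_le_abs hk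
    rw [norm_div, Complex.norm_I, norm_mul, norm_mul, Complex.norm_two, Complex.norm_real,
      Real.norm_eq_abs, abs_of_pos Real.pi_pos, Complex.norm_intCast, div_le_one (by positivity)]
    nlinarith [Real.pi_gt_three]
  calc ‖(I / (2 * π * (k i : ℂ))) ^ (l + 2) * ∫ τ in Ioi H, (b τ : ℂ) * chirpE φ (k i) (u i) τ‖
      ≤ 1 * (2 * C * T₀ ^ (-(1 / 2) : ℝ)) := by
        rw [norm_mul]
        exact mul_le_mul hq htail (norm_nonneg _) zero_le_one
    _ = 2 * C * T₀ ^ (-(1 / 2) : ℝ) := one_mul _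

end Literature.Analysis.Fourier
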